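import Summits.AtomisticToContinuum.Crystallization.Theorems.FrustratedLawDichotomyBumpSF45
import Summits.AtomisticToContinuum.Crystallization.Theorems.FrustratedLawDichotomySchurMotifFourHalf

/-!
# FrustratedLawDichotomy · column 27623 after `SF₄₅`: the crux from the two finite motif-certificate families ALONE (Door and SF₄₅ discharged)

With `…BumpSF45.sf₄₅_holds` (hand-1 g13: `SF₄₅` PROVED) hand-2 g12's motif doors at the range-9/2 node (`…SchurMotifFourHalf`) lose the
floor hypothesis.  The door `MuEquilibriumDoor` is PROVED in the tree (`…GrainCoreNetworkSplitMuEquilibriumDoor.muEquilibriumDoor`, hand-1 g8) but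
cannot be co-imported here (CO-IMPORT CAVEAT of record: `MuGSC.lean` vs `MuGroundStateConfiguration.lean` duplicate declarations — checked again:
`import … failed, environment already contains 'Literature.…UniformlyDiscrete'`), so it stays a hypothesis by name (two-module theorem of record);
`hU : PeriodicEnergyCeiling (−0.7175)` is the tree theorem `…PeriodicEnergyCeiling.periodicEnergyCeiling_holds` (computational leaf).  After this file:

  `AperiodicFrustratedLawGap ⟸ Door ∧ UP(−0.7175) ∧ [one motif-certified rule beneath T′♭₄₅] ∧ E′♭₄₅`   (`aperiodicFrustratedLawGap_of_motif_fourHalf`),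
  `AperiodicFrustratedLawGap ⟸ Door ∧ UP(−0.7175) ∧ [two motif-certified rules beneath T′♭₄₅, E′♭₄₅]`  (`aperiodicFrustratedLawGap_of_motifs_fourHalf`),
  `AperiodicFrustratedLawGap ⟸ Door ∧ UP(−0.7175) ∧ T′♭₄₅ ∧ E′♭₄₅`                                       (`aperiodicFrustratedLawGap_of_residuals_fourHalf`),

with Door and UP tree theorems: the energetic feed of column 27623 is EXACTLY its declared AREAL residual (the finite motif families / the Schur-cut
pricing statements).  [folklore] chaining; 0 sorry.  Prover hand 1, gen 13 (decomp-a2c), `--supports stmt-AtomisticToContinuum-27623`.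
-/

noncomputable section

namespace Summit.AtomisticToContinuum.Crystallization.Theorems.FrustratedLawDichotomyBumpAutocorrelation

open Summit.AtomisticToContinuum.Crystallization.Theorems.FrustratedLawDichotomyRangeCut
open Summit.AtomisticToContinuum.Crystallization.Theorems.FrustratedLawDichotomyLocalDischargingRule
open Summit.AtomisticToContinuum.Crystallization.Theorems.FrustratedLawDichotomySchurCut
open Summit.AtomisticToContinuum.Crystallization.Theorems.FrustratedLawDichotomyPairPotentialDoor
open Summit.AtomisticToContinuum.Crystallization.Theorems.FrustratedLawDichotomyMotifDoorE
open Summit.AtomisticToContinuum.Crystallization.Theorems.FrustratedLawDichotomySchurMotifFourHalf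

/-- ★★ **The crux from Door, `UP(−0.7175)`, `T′♭₄₅` and `E′♭₄₅`** (`SF₄₅` PROVED; Door by name). [folklore chaining] -/
theorem aperiodicFrustratedLawGap_of_residuals_fourHalf {CT CE DE : ℝ}
    (hDoor : Summit.AtomisticToContinuum.Crystallization.Theses.GrainCoreNetworkSplit.MuEquilibriumDoor) (hU : PeriodicEnergyCeiling (-(7175 / 10000)))
    (hT : SchurTopologicalPricing (1 / 20) (1 / 8) w₄₅ ω₄ (3 / 400) (-(7175 / 10000)) (1 / 100) CT)
    (hE : SchurElasticPricing (1 / 20) (1 / 8) w₄₅ ω₄ (3 / 400) (-(7175 / 10000)) (1 / 1000) CE DE) :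
    Summit.AtomisticToContinuum.Crystallization.Theses.FrustratedLawDichotomy.AperiodicFrustratedLawGap :=
  aperiodicFrustratedLawGap_of_fdg hDoor (fdg_of_split_schurCut_fourHalf sf₄₅_holds hU hT hE)

/-- ★★ **The crux from Door, `UP(−0.7175)`, ONE motif-certified rule beneath `T′♭₄₅`, and `E′♭₄₅`** (`SF₄₅` PROVED; Door by name). [folklore chaining] -/
theorem aperiodicFrustratedLawGap_of_motif_fourHalf {CT CE DE D ϱ R' ρ B : ℝ} {F : TransferRule}
    (hDoor : Summit.AtomisticToContinuum.Crystallization.Theses.GrainCoreNetworkSplit.MuEquilibriumDoor)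
    (hU : PeriodicEnergyCeiling (-(7175 / 10000)))
    (hE : SchurElasticPricing (1 / 20) (1 / 8) w₄₅ ω₄ (3 / 400) (-(7175 / 10000)) (1 / 1000) CE DE)
    (hF₁ : HasRange R' F) (hF₂ : IsLocal ρ F) (hF₃ : IsBounded B F)
    (hR : 9 / 2 ≤ ϱ) (hRρ : R' + ρ ≤ ϱ) (hρ : ρ ≤ ϱ) (hR' : R' ≤ ϱ) (hD : 13 / 10 * D + 1 ≤ ϱ) (hC : 0 ≤ CT)
    (h : PairRuleMotifCertificate (1 / 20) (1 / 8) (effPot w₄₅ ω₄ (3 / 400)) (3 / 400) (-(7175 / 10000) + 1 / 100) (-CT) (-(1 / 100))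
      D ϱ F) :
    Summit.AtomisticToContinuum.Crystallization.Theses.FrustratedLawDichotomy.AperiodicFrustratedLawGap :=
  aperiodicFrustratedLawGap_of_schurMotif_fourHalf hDoor sf₄₅_holds hU hE hF₁ hF₂ hF₃ hR hRρ hρ hR' hD hC h

/-- ★★★ **The crux from Door, `UP(−0.7175)` and TWO motif-certified rules** (`F_T` beneath `T′♭₄₅`, `F_E` beneath `E′♭₄₅`; `SF₄₅` PROVED; Door by name):
the energetic feed of column 27623 is its declared areal residual (two FINITE motif-certificate families at radius `ϱ ≥ 9/2`) and a tree number.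
[folklore chaining] -/
theorem aperiodicFrustratedLawGap_of_motifs_fourHalf {CT CE DE D ϱ R' ρ B R'' ρ' B' : ℝ} {FT FE : TransferRule}
    (hDoor : Summit.AtomisticToContinuum.Crystallization.Theses.GrainCoreNetworkSplit.MuEquilibriumDoor)
    (hU : PeriodicEnergyCeiling (-(7175 / 10000))) (hCT : 0 ≤ CT) (hCE : 0 ≤ CE) (hDE : 0 ≤ DE)
    (hT₁ : HasRange R' FT) (hT₂ : IsLocal ρ FT) (hT₃ : IsBounded B FT)
    (hE₁ : HasRange R'' FE) (hE₂ : IsLocal ρ' FE) (hE₃ : IsBounded B' FE)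
    (hR : 9 / 2 ≤ ϱ) (hRρ : R' + ρ ≤ ϱ) (hρ : ρ ≤ ϱ) (hR' : R' ≤ ϱ) (hRρ' : R'' + ρ' ≤ ϱ) (hρ'' : ρ' ≤ ϱ) (hR''' : R'' ≤ ϱ)
    (hD : 13 / 10 * D + 1 ≤ ϱ)
    (hT : PairRuleMotifCertificate (1 / 20) (1 / 8) (effPot w₄₅ ω₄ (3 / 400)) (3 / 400) (-(7175 / 10000) + 1 / 100) (-CT) (-(1 / 100))
      D ϱ FT)
    (hE : PairRuleMotifCertificateE (1 / 20) (1 / 8) (effPot w₄₅ ω₄ (3 / 400)) (3 / 400) (-(7175 / 10000) - DE) (-(1 / 1000 + CE))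
      (1 / 1000 + DE) D ϱ FE) :
    Summit.AtomisticToContinuum.Crystallization.Theses.FrustratedLawDichotomy.AperiodicFrustratedLawGap :=
  aperiodicFrustratedLawGap_of_schurMotifs_fourHalf hDoor sf₄₅_holds hU hCT hCE hDE hT₁ hT₂ hT₃ hE₁ hE₂ hE₃
    hR hRρ hρ hR' hRρ' hρ'' hR''' hD hT hE

/-- **The sibling `PeriodicFrustratedLawGap` (item 27624) from Door, `UP` and `FRG♭₄₅`** (`SF₄₅` PROVED; Door by name). [folklore chaining] -/
theorem periodicFrustratedLawGap_of_residual_fourHalf {C : ℝ}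
    (hDoor : Summit.AtomisticToContinuum.Crystallization.Theses.GrainCoreNetworkSplit.MuEquilibriumDoor) (hU : PeriodicEnergyCeiling (-(7175 / 10000)))
    (hG : SchurRangeGap w₄₅ ω₄ (3 / 400) (-(7174 / 10000)) C) :
    Summit.AtomisticToContinuum.Crystallization.Theses.FrustratedLawDichotomy.PeriodicFrustratedLawGap :=
  periodicFrustratedLawGap_of_schurCut hDoor sf₄₅_holds hU hG (by norm_num)

end Summit.AtomisticToContinuum.Crystallization.Theorems.FrustratedLawDichotomyBumpAutocorrelation

end
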